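import Mathlib.Algebra.BigOperators.Ring.Finset
import Mathlib.Algebra.Order.BigOperators.Ring.Finset
import Mathlib.Data.Fintype.Prod
import Mathlib.Data.Real.Basic
import Mathlib.Order.UpperLower.Basic
import Mathlib.Tactic.Linarith
import Mathlib.Tactic.Ring
import Mathlib.Tactic.Positivity

import HarnessLib
import HarnessLib.Audit

/-!
# `NoHeavyLowerTail` (crux stmt-CriticalPhenomena-4575), Sahi programme P4 (Holley / monotone coupling):
# linear read-once slots, file 1 — layers of a two-level pattern `Bool × Q` and the lifting of Harris' inequality

Support file (cell `prim-l12`, seat P4, generation 11; `--supports stmt-CriticalPhenomena-4575`).  No named facts, no sorries;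
standard axioms; def-free.

The flow certificates of `…SahiE3PatternCertificate` for the LINEAR READ-ONCE slot patterns
`x₁ ∘₁ (x₂ ∘₂ (⋯ x_k))` (`∘ ∈ {∧, ∨}`; e.g. `x₁ ∨ (x₂ ∧ (x₃ ∨ x₄))` = the hard-core pattern `1+23+24`, `x₁ ∨ x₂x₃x₄`, hitting sets,
principal filters) under PRODUCT pattern measures are built by recursion along the formula: one new top variable at a time, the
pattern becoming `Bool × Q` with the product order and the weight `ν(b, t) = w_b · ν'(t)`.  This file provides the bookkeeping for
that recursion: the decomposition of sums over subsets of `Bool × Q` into the two layers (`sum_layers`), the layers of an up-set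
(`isUpperSet_layer`, `layer_false_subset_true`), and the fact that Harris' inequality for up-sets lifts from `(Q, ν')` to
`(Bool × Q, ν)` (`harris_layers`: the two-point FKG step `(s₁ - s₀)(s₁' - s₀') ≥ 0`).  The certificate steps are in
`…SahiE3LroOrStep` / `…SahiE3LroAndStep`; HOME prim-l12-p4/FROM-prim-l12-p4-gen11-LRO-SLOTS.md.
-/

namespace Summit.CriticalPhenomena.PercolationContinuityZ3.Theorems.SahiE3LroLayers

open Finset
open scoped BigOperators

variable {Q : Type*} [Fintype Q] [DecidableEq Q]

/-- Layer `b` of a set of points of `Bool × Q`. [this work] -/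
theorem mem_layer (X : Finset (Bool × Q)) (b : Bool) (t : Q) :
    t ∈ univ.filter (fun t => (b, t) ∈ X) ↔ (b, t) ∈ X := by simp

/-- A sum over a finite set of `Bool × Q` splits into its two layers. [folklore] -/
theorem sum_layers (X : Finset (Bool × Q)) (f : Bool × Q → ℝ) :
    ∑ x ∈ X, f x = ∑ t ∈ univ.filter (fun t => (true, t) ∈ X), f (true, t)
      + ∑ t ∈ univ.filter (fun t => (false, t) ∈ X), f (false, t) := by
  rw [← Finset.sum_filter_add_sum_filter_not X (fun x => x.1 = true)]
  have h1 : X.filter (fun x => x.1 = true) = (univ.filter fun t => (true, t) ∈ X).image (fun t => (true, t)) := by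
    ext ⟨b, t⟩
    simp only [Finset.mem_filter, Finset.mem_image, Finset.mem_univ, true_and, Prod.mk.injEq]
    constructor
    · rintro ⟨h, rfl⟩; exact ⟨t, h, rfl, rfl⟩
    · rintro ⟨t', h, rfl, rfl⟩; exact ⟨h, rfl⟩
  have h2 : X.filter (fun x => ¬ x.1 = true) = (univ.filter fun t => (false, t) ∈ X).image (fun t => (false, t)) := by
    ext ⟨b, t⟩
    simp only [Finset.mem_filter, Finset.mem_image, Finset.mem_univ, true_and, Prod.mk.injEq,
      Bool.not_eq_true]
    constructor
    · rintro ⟨h, rfl⟩; exact ⟨t, h, rfl, rfl⟩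
    · rintro ⟨t', h, rfl, rfl⟩; exact ⟨h, rfl⟩
  rw [h1, h2, Finset.sum_image (fun a _ b _ h => by simpa using h),
    Finset.sum_image (fun a _ b _ h => by simpa using h)]

/-- The whole pattern `Bool × Q` has layers `univ`. [folklore] -/
theorem sum_layers_univ (f : Bool × Q → ℝ) :
    ∑ x, f x = ∑ t, f (true, t) + ∑ t, f (false, t) := by
  rw [sum_layers]; simp

variable [PartialOrder Q]

omit [Fintype Q] [DecidableEq Q] in
/-- An up-set of `Bool × Q` (product order) contains `(true, t)` whenever it contains `(false, t)`. [folklore] -/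
theorem mem_true_of_mem_false {S : Finset (Bool × Q)} (hS : IsUpperSet (S : Set (Bool × Q))) {t : Q}
    (h : (false, t) ∈ S) : (true, t) ∈ S := by
  have hle : ((false, t) : Bool × Q) ≤ (true, t) := ⟨Bool.false_le _, le_rfl⟩
  exact hS hle h

/-- The layers of an up-set of `Bool × Q` are up-sets of `Q`. [folklore] -/
theorem isUpperSet_layer {S : Finset (Bool × Q)} (hS : IsUpperSet (S : Set (Bool × Q))) (b : Bool) :
    IsUpperSet ((univ.filter (fun t => (b, t) ∈ S) : Finset Q) : Set Q) := by
  intro t t' htt' ht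
  simp only [Finset.coe_filter, Finset.mem_univ, true_and, Set.mem_setOf_eq] at ht ⊢
  exact hS (show ((b, t) : Bool × Q) ≤ (b, t') from ⟨le_rfl, htt'⟩) ht

/-- The `false`-layer of an up-set is contained in its `true`-layer. [folklore] -/
theorem layer_false_subset_true {S : Finset (Bool × Q)} (hS : IsUpperSet (S : Set (Bool × Q))) :
    univ.filter (fun t => (false, t) ∈ S) ⊆ univ.filter (fun t => (true, t) ∈ S) := by
  intro t ht
  simp only [Finset.mem_filter, Finset.mem_univ, true_and] at ht ⊢
  exact mem_true_of_mem_false hS ht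

omit [Fintype Q] [DecidableEq Q] [PartialOrder Q] in
/-- Mass of a subset is at most the mass of a superset, for a nonnegative weight. [folklore] -/
theorem sum_le_sum_of_subset' {ν : Q → ℝ} (hν : ∀ t, 0 ≤ ν t) {X Y : Finset Q} (h : X ⊆ Y) :
    ∑ t ∈ X, ν t ≤ ∑ t ∈ Y, ν t :=
  Finset.sum_le_sum_of_subset_of_nonneg h fun t _ _ => hν t

/-- **Harris lifts to a two-layer product.**  If `ν' ≥ 0` on `Q` satisfies Harris' inequality for up-sets
(`Z'·ν'(S ∩ S') ≥ ν'(S)·ν'(S')`), then so does the weight `ν(b, t) = w_b · ν'(t)` (`w_true = p, w_false = q ≥ 0`) on `Bool × Q`. [this work] -/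
theorem harris_layers {ν' : Q → ℝ} (hν' : ∀ t, 0 ≤ ν' t)
    (hH : ∀ S S' : Finset Q, IsUpperSet (S : Set Q) → IsUpperSet (S' : Set Q) →
      (∑ t ∈ S, ν' t) * (∑ t ∈ S', ν' t) ≤ (∑ t, ν' t) * ∑ t ∈ S ∩ S', ν' t)
    {p q : ℝ} (hp : 0 ≤ p) (hq : 0 ≤ q) (ν : Bool × Q → ℝ) (hνt : ∀ t, ν (true, t) = p * ν' t)
    (hνf : ∀ t, ν (false, t) = q * ν' t) (S S' : Finset (Bool × Q)) (hS : IsUpperSet (S : Set (Bool × Q)))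
    (hS' : IsUpperSet (S' : Set (Bool × Q))) :
    (∑ x ∈ S, ν x) * (∑ x ∈ S', ν x) ≤ (∑ x, ν x) * ∑ x ∈ S ∩ S', ν x := by
  -- layers
  set S1 := univ.filter (fun t => (true, t) ∈ S) with hS1
  set S0 := univ.filter (fun t => (false, t) ∈ S) with hS0
  set T1 := univ.filter (fun t => (true, t) ∈ S') with hT1
  set T0 := univ.filter (fun t => (false, t) ∈ S') with hT0
  have eS : ∑ x ∈ S, ν x = p * ∑ t ∈ S1, ν' t + q * ∑ t ∈ S0, ν' t := by
    rw [sum_layers, Finset.mul_sum, Finset.mul_sum]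
    exact congrArg₂ (· + ·) (Finset.sum_congr rfl fun t _ => hνt t) (Finset.sum_congr rfl fun t _ => hνf t)
  have eS' : ∑ x ∈ S', ν x = p * ∑ t ∈ T1, ν' t + q * ∑ t ∈ T0, ν' t := by
    rw [sum_layers, Finset.mul_sum, Finset.mul_sum]
    exact congrArg₂ (· + ·) (Finset.sum_congr rfl fun t _ => hνt t) (Finset.sum_congr rfl fun t _ => hνf t)
  have eZ : ∑ x, ν x = p * ∑ t, ν' t + q * ∑ t, ν' t := by
    rw [sum_layers_univ, Finset.mul_sum, Finset.mul_sum]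
    exact congrArg₂ (· + ·) (Finset.sum_congr rfl fun t _ => hνt t) (Finset.sum_congr rfl fun t _ => hνf t)
  have l1 : univ.filter (fun t => (true, t) ∈ S ∩ S') = S1 ∩ T1 := by ext t; simp [hS1, hT1]
  have l0 : univ.filter (fun t => (false, t) ∈ S ∩ S') = S0 ∩ T0 := by ext t; simp [hS0, hT0]
  have eI : ∑ x ∈ S ∩ S', ν x = p * ∑ t ∈ S1 ∩ T1, ν' t + q * ∑ t ∈ S0 ∩ T0, ν' t := by
    rw [sum_layers, l1, l0, Finset.mul_sum, Finset.mul_sum]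
    exact congrArg₂ (· + ·) (Finset.sum_congr rfl fun t _ => hνt t) (Finset.sum_congr rfl fun t _ => hνf t)
  -- Harris on the layers and monotonicity
  have u1 : IsUpperSet (S1 : Set Q) := isUpperSet_layer hS true
  have u0 : IsUpperSet (S0 : Set Q) := isUpperSet_layer hS false
  have v1 : IsUpperSet (T1 : Set Q) := isUpperSet_layer hS' true
  have v0 : IsUpperSet (T0 : Set Q) := isUpperSet_layer hS' false
  have H11 := hH S1 T1 u1 v1
  have H00 := hH S0 T0 u0 v0
  have H10 := hH S1 T0 u1 v0
  have H01 := hH S0 T1 u0 v1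
  have m1 : ∑ t ∈ S0, ν' t ≤ ∑ t ∈ S1, ν' t := sum_le_sum_of_subset' hν' (layer_false_subset_true hS)
  have m2 : ∑ t ∈ T0, ν' t ≤ ∑ t ∈ T1, ν' t := sum_le_sum_of_subset' hν' (layer_false_subset_true hS')
  have i10 : ∑ t ∈ S1 ∩ T0, ν' t ≤ ∑ t ∈ S1 ∩ T1, ν' t :=
    sum_le_sum_of_subset' hν' (Finset.inter_subset_inter_left (layer_false_subset_true hS'))
  have i01 : ∑ t ∈ S0 ∩ T1, ν' t ≤ ∑ t ∈ S1 ∩ T1, ν' t :=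
    sum_le_sum_of_subset' hν' (Finset.inter_subset_inter_right (layer_false_subset_true hS))
  have i00 : ∑ t ∈ S0 ∩ T0, ν' t ≤ ∑ t ∈ S0 ∩ T1, ν' t :=
    sum_le_sum_of_subset' hν' (Finset.inter_subset_inter_left (layer_false_subset_true hS'))
  have hZ' : 0 ≤ ∑ t, ν' t := Finset.sum_nonneg fun t _ => hν' t
  have hs0 : 0 ≤ ∑ t ∈ S0, ν' t := Finset.sum_nonneg fun t _ => hν' t
  have ht0 : 0 ≤ ∑ t ∈ T0, ν' t := Finset.sum_nonneg fun t _ => hν' t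
  rw [eS, eS', eZ, eI]
  -- (p s1 + q s0)(p t1 + q t0) ≤ (p+q) Z' (p i11 + q i00):  p² by H11, q² by H00 (+ Z' i00 ≤ Z' i00), pq cross terms by
  -- H10/H01 and i10, i01 ≥ ... plus the rearrangement (s1 - s0)(t1 - t0) ≥ 0
  nlinarith [mul_nonneg hp hq, mul_nonneg hp hp, mul_nonneg hq hq, H11, H00, H10, H01, m1, m2, i10, i01, i00,
    mul_nonneg (mul_nonneg hp hq) (mul_nonneg (sub_nonneg.2 m1) (sub_nonneg.2 m2)),
    mul_nonneg (mul_nonneg hp hq) hZ', mul_nonneg (mul_nonneg hp hp) hZ', mul_nonneg (mul_nonneg hq hq) hZ']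

end Summit.CriticalPhenomena.PercolationContinuityZ3.Theorems.SahiE3LroLayers
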